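import Mathlib
import Literature.RingTheory.TwoVariableSeries.Basic
import Literature.AlgebraicGeometry.Resolution.FormalShear
import Summits.ResolutionOfSingularities.ResolutionOfSingularities.Theorems.WeightedInvariantLocalWeightedDropMonicDescentShear

/-!
# `WeightedInvariant.LocalWeightedDrop`, sub-stub N4″: the label transports as substitutions, and their commutation with the `u₂`-shear (piece (t1))

Crux item stmt-ResolutionOfSingularities-8899 `LocalWeightedDrop` (route `ResolutionOfSingularities/WeightedInvariant`), door
`WeightedConstruction` stmt-ResolutionOfSingularities-0571.  [OURS · L1 W4.3, chain w43, lead prover; tool (t1) for pieces T-5′ (tail argument) and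
T-6′ (game bridge) of `N4PRIME-PLAN.md`.]

The coefficientwise transports `blowOne c A = A(u₁, u₁u₂)/u₁^c` and `divOne c A = A/u₁^c` of `…MonicDescentLabels` as honest ring operations:
* `coeff_subst_blowFamily` — coefficients of `A(u₁, u₁u₂) = subst ![X 0, X 0 * X 1] A`;
* `X_pow_mul_blowOne` — `u₁^c · blowOne c A = A(u₁, u₁u₂)` when every exponent of `A` has `e₀ + e₁ ≥ c`;
* `X_pow_mul_divOne` — `u₁^c · divOne c A = A` when every exponent has `e₀ ≥ c`;
* `blowOne_shear` — `blowOne c (A(u₁, u₂ + u₁·(u₁ g))) = (blowOne c A)(u₁, u₂ + u₁ g)` for `g = g(u₁)` (the `u₂`-shear by `u₁g` downstairs is the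
  shear by `g` upstairs: CJS's `v/u₁ = v⁽¹⁾`), and `divOne_shear` — `divOne c` commutes with every `u₂`-shear.
-/

set_option linter.dupNamespace false -- mandated namespace of this single-conjunct summit

noncomputable section

namespace Summit.ResolutionOfSingularities.ResolutionOfSingularities.Theorems

namespace MonicDescent

open MvPowerSeries Literature.RingTheory.TwoVariableSeries Literature.AlgebraicGeometry.Resolution

variable {k : Type} [Field k]

/-- The `u₁`-chart family `(u₁, u₁u₂)` has zero constant terms. -/
theorem constantCoeff_blowFamily : ∀ i, constantCoeff (![X 0, X 0 * X 1] i : MvPowerSeries (Fin 2) k) = 0 := by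
  intro i
  fin_cases i
  · exact constantCoeff_X 0
  · show constantCoeff (X 0 * X 1) = 0
    rw [map_mul, constantCoeff_X, zero_mul]

/-- COEFFICIENTS OF `A(u₁, u₁u₂)`: the monomial `u^e` goes to `u₁^{e₀+e₁} u₂^{e₁}`. -/
theorem coeff_subst_blowFamily (A : MvPowerSeries (Fin 2) k) (d : Fin 2 →₀ ℕ) :
    coeff d (subst ![X 0, X 0 * X 1] A) =
      if d 1 ≤ d 0 then coeff (Finsupp.single 0 (d 0 - d 1) + Finsupp.single 1 (d 1)) A else 0 := by
  classical
  have hs : HasSubst ![(X 0 : MvPowerSeries (Fin 2) k), X 0 * X 1] := hasSubst_of_constantCoeff_zero constantCoeff_blowFamily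
  rw [coeff_subst hs]
  have hprod : ∀ e : Fin 2 →₀ ℕ, (e.prod fun s m => (![(X 0 : MvPowerSeries (Fin 2) k), X 0 * X 1] s) ^ m) =
      monomial (Finsupp.single 0 (e 0 + e 1) + Finsupp.single 1 (e 1)) 1 := by
    intro e
    rw [Finsupp.prod_fintype _ _ (fun i => pow_zero _), Fin.prod_univ_two]
    show X 0 ^ e 0 * (X 0 * X 1) ^ e 1 = _
    rw [mul_pow, ← mul_assoc, ← pow_add, X_pow_eq, X_pow_eq, monomial_mul_monomial, one_mul]
  simp_rw [hprod, coeff_monomial]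
  by_cases hd : d 1 ≤ d 0
  · rw [if_pos hd]
    rw [finsum_eq_single _ (Finsupp.single 0 (d 0 - d 1) + Finsupp.single 1 (d 1))]
    · rw [if_pos, smul_eq_mul, mul_one]
      refine finsupp_fin2_ext ?_ ?_
      · simp only [Finsupp.add_apply, Finsupp.single_apply]; simp; omega
      · simp only [Finsupp.add_apply, Finsupp.single_apply]; simp
    · intro e hne
      rw [if_neg, smul_zero]
      intro hde
      apply hne
      have h0 := congrArg (fun P => P 0) hde
      have h1 := congrArg (fun P => P 1) hde
      simp only [Finsupp.add_apply, Finsupp.single_apply] at h0 h1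
      simp at h0 h1
      refine finsupp_fin2_ext ?_ ?_
      · simp only [Finsupp.add_apply, Finsupp.single_apply]; simp; omega
      · simp only [Finsupp.add_apply, Finsupp.single_apply]; simp; omega
  · rw [if_neg hd]
    apply finsum_eq_zero_of_forall_eq_zero
    intro e
    rw [if_neg, smul_zero]
    intro hde
    apply hd
    have h0 := congrArg (fun P => P 0) hde
    have h1 := congrArg (fun P => P 1) hde
    simp only [Finsupp.add_apply, Finsupp.single_apply] at h0 h1
    simp at h0 h1
    omega

/-- `u₁^c · blowOne c A = A(u₁, u₁u₂)` when every exponent of `A` has `e₀ + e₁ ≥ c`. -/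
theorem X_pow_mul_blowOne (c : ℕ) (A : MvPowerSeries (Fin 2) k) (hA : ∀ e : Fin 2 →₀ ℕ, coeff e A ≠ 0 → c ≤ e 0 + e 1) :
    X 0 ^ c * blowOne c A = subst ![X 0, X 0 * X 1] A := by
  ext d
  rw [coeff_subst_blowFamily, X_pow_eq, coeff_monomial_mul]
  by_cases hc : Finsupp.single 0 c ≤ d
  · rw [if_pos hc, one_mul, coeff_blowOne]
    have hd0 : c ≤ d 0 := by simpa using hc 0
    have hsub0 : (d - Finsupp.single 0 c : Fin 2 →₀ ℕ) 0 = d 0 - c := by simp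
    have hsub1 : (d - Finsupp.single 0 c : Fin 2 →₀ ℕ) 1 = d 1 := by simp
    rw [hsub0, hsub1]
    by_cases hd : d 1 ≤ d 0
    · rw [if_pos hd]
      by_cases hd' : d 1 ≤ d 0 - c + c
      · rw [if_pos hd']
        have hidx : Finsupp.single 0 (d 0 - c + c - d 1) + Finsupp.single 1 (d 1) =
            (Finsupp.single 0 (d 0 - d 1) + Finsupp.single 1 (d 1) : Fin 2 →₀ ℕ) := by
          refine finsupp_fin2_ext ?_ ?_
          · simp only [Finsupp.add_apply, Finsupp.single_apply]; simp; omega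
          · simp only [Finsupp.add_apply, Finsupp.single_apply]; simp
        rw [hidx]
      · exfalso; omega
    · rw [if_neg hd, if_neg (by omega)]
  · rw [if_neg hc]
    have hd0 : d 0 < c := by
      by_contra hge
      push Not at hge
      exact hc (by intro i; fin_cases i <;> simp [hge])
    split_ifs with hd
    · symm
      by_contra hne
      have := hA _ hne
      simp only [Finsupp.add_apply, Finsupp.single_apply] at this
      simp at this
      omega
    · rfl

/-- `u₁^c · divOne c A = A` when every exponent of `A` has `e₀ ≥ c`. -/
theorem X_pow_mul_divOne (c : ℕ) (A : MvPowerSeries (Fin 2) k) (hA : ∀ e : Fin 2 →₀ ℕ, coeff e A ≠ 0 → c ≤ e 0) :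
    X 0 ^ c * divOne c A = A := by
  ext d
  rw [X_pow_eq, coeff_monomial_mul]
  by_cases hc : Finsupp.single 0 c ≤ d
  · rw [if_pos hc, one_mul, coeff_divOne]
    have hidx : (d - Finsupp.single 0 c : Fin 2 →₀ ℕ) + Finsupp.single 0 c = d := by
      refine finsupp_fin2_ext ?_ ?_
      · have : c ≤ d 0 := by simpa using hc 0
        simp only [Finsupp.add_apply, Finsupp.single_apply, Finsupp.tsub_apply]; simp; omega
      · simp only [Finsupp.add_apply, Finsupp.single_apply, Finsupp.tsub_apply]; simp
    rw [hidx]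
  · rw [if_neg hc]
    symm
    by_contra hne
    have := hA d hne
    exact hc (by intro i; fin_cases i <;> simp [this])

/-- `MvPowerSeries (Fin 2) k` has no zero divisors; `u₁^c` is left-cancellable. -/
theorem X_pow_mul_left_cancel {c : ℕ} {A B : MvPowerSeries (Fin 2) k} (h : X 0 ^ c * A = X 0 ^ c * B) : A = B :=
  mul_left_cancel₀ (pow_ne_zero c (X_ne_zero' (0 : Fin 2))) h

/-- The `u₂`-shear fixes series in `u₁` only. -/
theorem shear_eq_self_of_noY (h g : MvPowerSeries (Fin 2) k) (hg : ∀ e : Fin 2 →₀ ℕ, e 1 ≠ 0 → coeff e g = 0) : shear h g = g := by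
  rw [shear_eq]
  exact FormalShear.subst_eq_self_of_noY (hasSubst_of_constantCoeff_zero (constantCoeff_shearFamily h)) rfl hg

/-- COMMUTATION (CJS `v⁽¹⁾ = v/u₁`): for `g = g(u₁)`, the `u₁`-chart of the label sheared by `u₁g` is the `u₁`-chart label sheared by `g`:
`blowOne c (A(u₁, u₂ + u₁·u₁g)) = (blowOne c A)(u₁, u₂ + u₁g)`, for `A` of order `≥ c`. -/
theorem blowOne_shear (c : ℕ) (g A : MvPowerSeries (Fin 2) k) (hg : ∀ e : Fin 2 →₀ ℕ, e 1 ≠ 0 → coeff e g = 0)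
    (hA : ∀ e : Fin 2 →₀ ℕ, coeff e A ≠ 0 → c ≤ e 0 + e 1) :
    blowOne c (shear (X 0 * g) A) = shear g (blowOne c A) := by
  have hσ : HasSubst ![(X 0 : MvPowerSeries (Fin 2) k), X 0 * X 1] := hasSubst_of_constantCoeff_zero constantCoeff_blowFamily
  have hτ : ∀ h : MvPowerSeries (Fin 2) k, HasSubst ![X 0, X 1 + X 0 * h] :=
    fun h => hasSubst_of_constantCoeff_zero (constantCoeff_shearFamily h)
  -- exponents of the sheared series still have `e₀ + e₁ ≥ c` (orders do not drop)
  have hA' : ∀ e : Fin 2 →₀ ℕ, coeff e (shear (X 0 * g) A) ≠ 0 → c ≤ e 0 + e 1 := by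
    intro e he
    by_contra hlt
    push Not at hlt
    apply he
    have hord : (c : ℕ∞) ≤ A.order := by
      apply MvPowerSeries.le_order
      intro d hd
      by_contra hne
      have := hA d hne
      have hdeg : Finsupp.degree d = d 0 + d 1 := by rw [Finsupp.degree_eq_sum]; simp [Fin.sum_univ_two]
      rw [hdeg] at hd
      exact absurd this (not_le.mpr (by exact_mod_cast hd))
    apply coeff_of_lt_order
    rw [shear_eq]
    refine lt_of_lt_of_le ?_ (le_trans hord (FormalShear.order_le_order_subst' _ (constantCoeff_shearFamily _) A))
    have hdeg : Finsupp.degree e = e 0 + e 1 := by rw [Finsupp.degree_eq_sum]; simp [Fin.sum_univ_two]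
    rw [hdeg]
    exact_mod_cast hlt
  apply X_pow_mul_left_cancel (c := c)
  rw [X_pow_mul_blowOne c _ hA', ← shear_X_pow_mul, X_pow_mul_blowOne c A hA, shear_eq, shear_eq,
    subst_comp_subst_apply (hτ _) hσ, subst_comp_subst_apply hσ (hτ _)]
  congr 1
  funext i
  fin_cases i
  · show subst ![X 0, X 0 * X 1] (X 0) = subst ![X 0, X 1 + X 0 * g] (X 0)
    rw [subst_X hσ, subst_X (hτ g)]
    rfl
  · show subst ![X 0, X 0 * X 1] (X 1 + X 0 * (X 0 * g)) = subst ![X 0, X 1 + X 0 * g] (X 0 * X 1)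
    rw [subst_add hσ, subst_mul hσ, subst_mul hσ, subst_X hσ, subst_X hσ, subst_mul (hτ g), subst_X (hτ g), subst_X (hτ g)]
    have hgfix : subst ![X 0, X 0 * X 1] g = g :=
      FormalShear.subst_eq_self_of_noY hσ rfl hg
    rw [hgfix]
    show X 0 * X 1 + X 0 * (X 0 * g) = X 0 * (X 1 + X 0 * g)
    ring

/-- `divOne c` commutes with every `u₂`-shear (on series divisible by `u₁^c`). -/
theorem divOne_shear (c : ℕ) (h A : MvPowerSeries (Fin 2) k) (hA : ∀ e : Fin 2 →₀ ℕ, coeff e A ≠ 0 → c ≤ e 0) :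
    divOne c (shear h A) = shear h (divOne c A) := by
  have hfac : shear h A = X 0 ^ c * shear h (divOne c A) := by
    rw [← shear_X_pow_mul, X_pow_mul_divOne c A hA]
  have hA' : ∀ e : Fin 2 →₀ ℕ, coeff e (shear h A) ≠ 0 → c ≤ e 0 := by
    intro e he
    by_contra hlt
    push Not at hlt
    apply he
    rw [hfac]
    exact (X_pow_dvd_iff.mp (Dvd.intro _ rfl)) e hlt
  apply X_pow_mul_left_cancel (c := c)
  rw [X_pow_mul_divOne c _ hA', hfac]

end MonicDescent

end Summit.ResolutionOfSingularities.ResolutionOfSingularities.Theorems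

end
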